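import Summits.FinalStateConjecture.FinalStateConjecture.Theses.EternalPapapetrou
import Summits.FinalStateConjecture.FinalStateConjecture.Theses.ConcentrationCannotWait
import Summits.FinalStateConjecture.FinalStateConjecture.Theorems.SwallowTheDatumMGHDExists
import Summits.FinalStateConjecture.FinalStateConjecture.Theorems.SwallowTheDatumSubdataDevelopmentsEmbedLocalisationLocallyUnique
import Literature.Geometry.Lorentzian.CommonDevelopmentProperExtension
import Literature.Geometry.Lorentzian.MCGHDNoCorrespondingBoundary
import Literature.Geometry.Lorentzian.ChainUnionDevelopment
import Literature.Geometry.Lorentzian.DataEmbeddingNormalSmooth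

/-!
# Routes EternalPapapetrou / ConcentrationCannotWait · item `MGHDExists` = `MaximalDevelopmentExists`
# (stmt-FinalStateConjecture-9981) — conditional closure, identification with the sibling item,
# and the item from local existence given the two registered facts of the local theory

The statement item stmt-FinalStateConjecture-9981 is rendered by the gate as
`Summit.FinalStateConjecture.FinalStateConjecture.Theses.ConcentrationCannotWait.MaximalDevelopmentExists`
(home route) and as `Summit.FinalStateConjecture.FinalStateConjecture.Theses.EternalPapapetrou.MGHDExists`;
both read, verbatim: for every connected, Hausdorff, second countable smooth `3`-manifold `X` and
every Christodoulou-admissible vacuum datum `D ∈ admissibleVacuumData X` there is a maximal vacuum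
Cauchy development `𝒟 : VacuumCauchyDevelopment D`, `𝒟.IsMaximal` — Choquet-Bruhat–Geroch, Comm.
Math. Phys. 14 (1969), Thm. 3 (p. 332), restricted to the admissible class; i.e. the registered
named fact `Literature.Geometry.Lorentzian.choquetBruhat_geroch_exists_mghd_cauchy`
(`CauchyProblemMGHDExistence.lean`) restricted to admissible data, and the SAME proposition as the
sibling item `…Theses.SwallowTheDatum.MGHDExists` (stmt-FinalStateConjecture-9937), for which
`Theorems/SwallowTheDatumMGHDExists.lean` and `Theorems/SwallowTheDatumMGHDExistsInputs.lean`
already record the conditional closure and the reduction to the inputs of the printed proof.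

This file lands, for item 9981:

* `eternalPapapetrou_mghdExists_of_choquetBruhatGeroch`,
  `concentrationCannotWait_maximalDevelopmentExists_of_choquetBruhatGeroch` — the CONDITIONAL
  closures of the two renderings from the named fact (trust base: Choquet-Bruhat–Geroch 1969,
  Thm. 3; closing line once `choquetBruhat_geroch_exists_mghd_cauchy_holds` exists:
  `eternalPapapetrou_mghdExists_of_choquetBruhatGeroch choquetBruhat_geroch_exists_mghd_cauchy_holds`);
* `eternalPapapetrou_mghdExists_iff_swallowTheDatum_mghdExists`,
  `concentrationCannotWait_maximalDevelopmentExists_iff_eternalPapapetrou_mghdExists` — the three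
  renderings are one proposition (`Iff.rfl`), so everything landed for item 9937 transfers;
* `choquetBruhatGeroch_of_localExistence_of_locallyUnique_of_thm12` — **the named fact itself from
  LOCAL EXISTENCE alone, given the two REGISTERED facts of the local theory**: since
  `SwallowTheDatumMGHDExistsInputs.lean` landed, the tree registered
  `hawkingEllis_locallyUnique_vacuumDevelopment` (Choquet-Bruhat–Geroch 1969, Thm. 2 = Hawking–Ellis
  1973, §7.5: any two developments are extensions of a common one; `CauchyProblemLocalUniqueness`)
  and `sbierski_commonDevelopment_lt_of_hasCorrespondingBoundaryPoints` (Sbierski 2016, §3.2,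
  Thm. 12: a common development with corresponding boundary points is strictly contained in a
  larger one; `CommonDevelopmentProperExtension`), and proved the union of chains
  (`ChainUnionDevelopment`) and the gluing along the maximal common development
  (`MCGHDNoCorrespondingBoundary`, `DevelopmentGluing*`). Composing them: Choquet-Bruhat–Geroch's
  Theorem 3 follows from their Theorem 1 ("Every initial data set has a development", p. 331;
  Fourès-Bruhat 1952) displayed as the hypothesis `hex`, and the two registered facts;
* `eternalPapapetrou_mghdExists_of_localExistence_of_locallyUnique_of_thm12` — hence the item from
  the same three inputs;
  `eternalPapapetrou_mghdExists_iff_localExistence_of_locallyUnique_of_thm12` — **given the two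
  registered facts, the item is EQUIVALENT to local existence on the admissible class**
  (`∀ D ∈ admissibleVacuumData X, Nonempty (VacuumCauchyDevelopment D)`), which is therefore the
  exact remaining content of the item over the tree (quasilinear hyperbolic local existence for
  the vacuum Einstein equations in wave gauge — no carrier in Mathlib at the pin); and its backward
  direction `eternalPapapetrou_mghdExists_of_localExistenceAdmissible_of_locallyUnique_of_thm12`,
  the item from the weakest local-existence input.

Pure composition over the tree; no definition, no new named fact, nothing restated.

## References

* Y. Choquet-Bruhat, R. Geroch, *Global aspects of the Cauchy problem in general relativity*,
  Comm. Math. Phys. 14 (1969) 329–335: Thm. 1, Thm. 2 (p. 331), Thm. 3 (p. 332) and its proof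
  (pp. 332–334). [ChoquetBruhatGeroch1969CMP]
* J. Sbierski, *On the existence of a maximal Cauchy development for the Einstein equations: a
  dezornification*, Ann. Henri Poincaré 17 (2016) 301–329 = arXiv:1309.7591v3: Thm. 4 (local
  existence and uniqueness), Thm. 5, Thm. 6, §3.2 Thm. 12, §3.3 (arXiv numbering). [Sbierski2016AHP]
* S. W. Hawking, G. F. R. Ellis, *The large scale structure of space-time*, CUP 1973, §7.5–7.6.
  [HawkingEllis1973CUP]
-/

noncomputable section

open scoped Manifold ContDiff Topology

-- `Summit.FinalStateConjecture.FinalStateConjecture.…`: summit = sub-problem name (D-0017), as in every file here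
set_option linter.dupNamespace false

namespace Summit.FinalStateConjecture.FinalStateConjecture.Theorems

open Literature.Geometry.Lorentzian

/-! ### The renderings are one proposition -/

/-- The rendering `EternalPapapetrou.MGHDExists` of item 9981 and the sibling item
`SwallowTheDatum.MGHDExists` (stmt-FinalStateConjecture-9937) are the same proposition
(syntactically identical bodies): every theorem of `SwallowTheDatumMGHDExists.lean` /
`SwallowTheDatumMGHDExistsInputs.lean` about the latter is a theorem about the former. -/
theorem eternalPapapetrou_mghdExists_iff_swallowTheDatum_mghdExists :
    Summit.FinalStateConjecture.FinalStateConjecture.Theses.EternalPapapetrou.MGHDExists ↔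
      Summit.FinalStateConjecture.FinalStateConjecture.Theses.SwallowTheDatum.MGHDExists :=
  Iff.rfl

/-- The two renderings of item 9981, `ConcentrationCannotWait.MaximalDevelopmentExists` (home
route) and `EternalPapapetrou.MGHDExists`, are the same proposition. -/
theorem concentrationCannotWait_maximalDevelopmentExists_iff_eternalPapapetrou_mghdExists :
    Summit.FinalStateConjecture.FinalStateConjecture.Theses.ConcentrationCannotWait.MaximalDevelopmentExists ↔
      Summit.FinalStateConjecture.FinalStateConjecture.Theses.EternalPapapetrou.MGHDExists :=
  Iff.rfl

/-! ### Conditional closure from the named fact -/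

/-- **Conditional closure of item `MGHDExists` (stmt-FinalStateConjecture-9981), route
EternalPapapetrou.** Under the named fact `choquetBruhat_geroch_exists_mghd_cauchy`
(Choquet-Bruhat–Geroch 1969, Thm. 3: every smooth solution of the vacuum constraints on a
connected Hausdorff second countable `3`-manifold has a maximal vacuum Cauchy development), every
admissible vacuum datum has a maximal vacuum Cauchy development. Transferred verbatim from the
sibling item's `mghdExists_of_choquetBruhatGeroch` (`SwallowTheDatumMGHDExists.lean`, one line over
`choquetBruhat_geroch_exists_mghd_cauchy.exists_isMaximal_of_mem_admissibleVacuumData`).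
CONDITIONAL: trust base = the undischarged fact; closing line once it is discharged:
`eternalPapapetrou_mghdExists_of_choquetBruhatGeroch choquetBruhat_geroch_exists_mghd_cauchy_holds`. -/
theorem eternalPapapetrou_mghdExists_of_choquetBruhatGeroch
    (h : choquetBruhat_geroch_exists_mghd_cauchy) :
    Summit.FinalStateConjecture.FinalStateConjecture.Theses.EternalPapapetrou.MGHDExists :=
  eternalPapapetrou_mghdExists_iff_swallowTheDatum_mghdExists.2 (mghdExists_of_choquetBruhatGeroch h)

/-- **Conditional closure of the home rendering `MaximalDevelopmentExists`
(stmt-FinalStateConjecture-9981, route ConcentrationCannotWait)** from the named fact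
`choquetBruhat_geroch_exists_mghd_cauchy` (Choquet-Bruhat–Geroch 1969, Thm. 3), through
`eternalPapapetrou_mghdExists_of_choquetBruhatGeroch`. CONDITIONAL: trust base = the fact. -/
theorem concentrationCannotWait_maximalDevelopmentExists_of_choquetBruhatGeroch
    (h : choquetBruhat_geroch_exists_mghd_cauchy) :
    Summit.FinalStateConjecture.FinalStateConjecture.Theses.ConcentrationCannotWait.MaximalDevelopmentExists :=
  concentrationCannotWait_maximalDevelopmentExists_iff_eternalPapapetrou_mghdExists.2
    (eternalPapapetrou_mghdExists_of_choquetBruhatGeroch h)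

/-! ### The fact, and the item, from local existence given the registered local theory -/

/-- **Choquet-Bruhat–Geroch's Theorem 3 from their Theorem 1, given the two registered facts of
the local theory.** If every smooth solution of the vacuum constraints on a connected Hausdorff
second countable `3`-manifold has SOME vacuum Cauchy development (`hex`: Choquet-Bruhat–Geroch
1969, Thm. 1, p. 331, "Every initial data set has a development"; Fourès-Bruhat 1952; Sbierski
2016, Thm. 4, first clause), then — under the registered facts
`hawkingEllis_locallyUnique_vacuumDevelopment` (their Thm. 2, p. 331: any two developments are
extensions of a common one) and `sbierski_commonDevelopment_lt_of_hasCorrespondingBoundaryPoints`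
(Sbierski 2016, Thm. 12) — every such datum has a MAXIMAL vacuum Cauchy development, i.e. the
named fact `choquetBruhat_geroch_exists_mghd_cauchy` holds. Proof: the Zorn frame with chains
bounded by the union development
(`choquetBruhat_geroch_exists_mghd_cauchy_of_localExistence_of_common_extension`,
`ChainUnionDevelopment`), fed with the common extension obtained by gluing along the maximal common
globally hyperbolic development (`choquetBruhat_geroch_common_extension_of_localTheory_of_exists_lt`,
`MCGHDNoCorrespondingBoundary`), whose local-theory input in the realised shape is
`SubdataDevelopmentsEmbed.exists_isCommonDevelopment_of_locallyUnique` and whose differentiability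
hypothesis on unit normals is the theorem `DataEmbedding.mdifferentiableAt_embed_normal`.
[cite: ChoquetBruhatGeroch1969CMP, Thm. 3, proof (pp. 332–334) from Thm. 1 and Thm. 2 (p. 331)]
[cite: Sbierski2016AHP, §3.3, proof of Thm. 5 and Thm. 6 from Thm. 4, Thm. 10, Thm. 12 (arXiv:1309.7591v3 numbering)] -/
theorem choquetBruhatGeroch_of_localExistence_of_locallyUnique_of_thm12
    (hex : ∀ (X : Type) [TopologicalSpace X] [ChartedSpace E3 X] [IsManifold (𝓡 3) ∞ X]
      [T2Space X] [SecondCountableTopology X] [ConnectedSpace X] (D : InitialDataSet (𝓡 3) X)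
      [D.metric.HasLeviCivita], D.IsVacuumConstraintSolution → Nonempty (VacuumCauchyDevelopment D))
    (hlu : hawkingEllis_locallyUnique_vacuumDevelopment)
    (h12 : sbierski_commonDevelopment_lt_of_hasCorrespondingBoundaryPoints) :
    choquetBruhat_geroch_exists_mghd_cauchy :=
  choquetBruhat_geroch_exists_mghd_cauchy_of_localExistence_of_common_extension hex
    fun X _ _ _ _ _ _ D _ _ ↦
      choquetBruhat_geroch_common_extension_of_localTheory_of_exists_lt
        (SubdataDevelopmentsEmbed.exists_isCommonDevelopment_of_locallyUnique hlu X D) (h12 X D)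
        fun 𝒟 x ↦ 𝒟.toDataEmbedding.mdifferentiableAt_embed_normal x

/-- **Item `MGHDExists` (stmt-FinalStateConjecture-9981) from local existence, given the two
registered facts of the local theory**: `eternalPapapetrou_mghdExists_of_choquetBruhatGeroch`
composed with `choquetBruhatGeroch_of_localExistence_of_locallyUnique_of_thm12`. The displayed
hypothesis `hex` is Choquet-Bruhat–Geroch 1969, Thm. 1 (local existence, Fourès-Bruhat 1952); the
other two are registered named facts (their Thm. 2; Sbierski 2016, Thm. 12).
[cite: ChoquetBruhatGeroch1969CMP, Thm. 3 from Thm. 1 and Thm. 2 (pp. 331–334)] -/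
theorem eternalPapapetrou_mghdExists_of_localExistence_of_locallyUnique_of_thm12
    (hex : ∀ (X : Type) [TopologicalSpace X] [ChartedSpace E3 X] [IsManifold (𝓡 3) ∞ X]
      [T2Space X] [SecondCountableTopology X] [ConnectedSpace X] (D : InitialDataSet (𝓡 3) X)
      [D.metric.HasLeviCivita], D.IsVacuumConstraintSolution → Nonempty (VacuumCauchyDevelopment D))
    (hlu : hawkingEllis_locallyUnique_vacuumDevelopment)
    (h12 : sbierski_commonDevelopment_lt_of_hasCorrespondingBoundaryPoints) :
    Summit.FinalStateConjecture.FinalStateConjecture.Theses.EternalPapapetrou.MGHDExists :=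
  eternalPapapetrou_mghdExists_of_choquetBruhatGeroch
    (choquetBruhatGeroch_of_localExistence_of_locallyUnique_of_thm12 hex hlu h12)

/-- **Given the two registered facts of the local theory, item `MGHDExists`
(stmt-FinalStateConjecture-9981) is EQUIVALENT to local existence on the admissible class.**
Forward: a maximal development is a development. Backward, per admissible datum `D`: the Zorn
frame with chains bounded by the union of chains
(`VacuumCauchyDevelopment.exists_isMaximal_of_nonempty_of_common_extension`, `ChainUnionDevelopment`)
and the common extension by gluing along the maximal common globally hyperbolic development
(`choquetBruhat_geroch_common_extension_of_localTheory_of_exists_lt`), with the local theory from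
`hawkingEllis_locallyUnique_vacuumDevelopment` in the realised shape
(`SubdataDevelopmentsEmbed.exists_isCommonDevelopment_of_locallyUnique`) and Theorem 12 from
`sbierski_commonDevelopment_lt_of_hasCorrespondingBoundaryPoints`. So over the tree the item's
remaining content is exactly Choquet-Bruhat–Geroch 1969, Thm. 1 (Fourès-Bruhat 1952) for
admissible data. [cite: ChoquetBruhatGeroch1969CMP, Thm. 3, proof (pp. 332–334) from Thm. 1 and Thm. 2]
[cite: Sbierski2016AHP, §3.3 (arXiv:1309.7591v3: Thm. 6 from Thm. 4, Thm. 10, Thm. 12)] -/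
theorem eternalPapapetrou_mghdExists_iff_localExistence_of_locallyUnique_of_thm12
    (hlu : hawkingEllis_locallyUnique_vacuumDevelopment)
    (h12 : sbierski_commonDevelopment_lt_of_hasCorrespondingBoundaryPoints) :
    Summit.FinalStateConjecture.FinalStateConjecture.Theses.EternalPapapetrou.MGHDExists ↔
      ∀ (X : Type) [TopologicalSpace X] [ChartedSpace E3 X] [IsManifold (𝓡 3) ∞ X]
        [T2Space X] [SecondCountableTopology X] [ConnectedSpace X] (D : InitialDataSet (𝓡 3) X),
        D ∈ admissibleVacuumData X → Nonempty (VacuumCauchyDevelopment D) := by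
  unfold Theses.EternalPapapetrou.MGHDExists
  constructor
  · intro h X _ _ _ _ _ _ D hD
    obtain ⟨𝒟, -⟩ := h X D hD
    exact ⟨𝒟⟩
  · intro hex X _ _ _ _ _ _ D hD
    exact VacuumCauchyDevelopment.exists_isMaximal_of_nonempty_of_common_extension (hex X D hD)
      (choquetBruhat_geroch_common_extension_of_localTheory_of_exists_lt
        (SubdataDevelopmentsEmbed.exists_isCommonDevelopment_of_locallyUnique hlu X D) (h12 X D)
        fun 𝒟 x ↦ 𝒟.toDataEmbedding.mdifferentiableAt_embed_normal x)

/-- **Item `MGHDExists` (stmt-FinalStateConjecture-9981) from local existence ON THE ADMISSIBLE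
CLASS ONLY, given the two registered facts of the local theory** — the weakest local-existence
input that yields the item (backward direction of
`eternalPapapetrou_mghdExists_iff_localExistence_of_locallyUnique_of_thm12`).
[cite: ChoquetBruhatGeroch1969CMP, Thm. 3 from Thm. 1 and Thm. 2 (pp. 331–334)] -/
theorem eternalPapapetrou_mghdExists_of_localExistenceAdmissible_of_locallyUnique_of_thm12
    (hex : ∀ (X : Type) [TopologicalSpace X] [ChartedSpace E3 X] [IsManifold (𝓡 3) ∞ X]
      [T2Space X] [SecondCountableTopology X] [ConnectedSpace X] (D : InitialDataSet (𝓡 3) X),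
      D ∈ admissibleVacuumData X → Nonempty (VacuumCauchyDevelopment D))
    (hlu : hawkingEllis_locallyUnique_vacuumDevelopment)
    (h12 : sbierski_commonDevelopment_lt_of_hasCorrespondingBoundaryPoints) :
    Summit.FinalStateConjecture.FinalStateConjecture.Theses.EternalPapapetrou.MGHDExists :=
  (eternalPapapetrou_mghdExists_iff_localExistence_of_locallyUnique_of_thm12 hlu h12).2 hex

end Summit.FinalStateConjecture.FinalStateConjecture.Theorems

end
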